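import Summits.Ventures.Crystal3D.Theorems.StickyWulffConstantGenericWallFloorCapperStar
import Summits.Ventures.Crystal3D.Theorems.StickyWulffConstantGenericWallFloorExitCertified
import HarnessLib

/-!
# The capper step of the stack walk: a capper is unsaturated, full in the twin grain, or an ORIENTED twin cap

HONEST FRAMING. Part of the venture `Summits/Ventures/Crystal3D` (cell `crystal3d-full`), helper
`--supports` the crux `GenericWallFloor` (stmt-Ventures-19480) of `route-Ventures-StickyWulffConstant`,
registered line `WallLedgerG`, open stub `stub_twoSlabAdhesion` (general fillings).  Brick of the STACK WALK
(translate rule) ledger.  wulff-p2's `capper_trichotomy` (`…CapperStar`) says: a capper `f = e + A′ w₀` of an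
exact twin cap `e` (twin frame `A′`, normal `n`, `⟪A′ w₀, n⟫ > 0`) has `≤ 11` contacts, or a full `A′`-shell,
or is an exact twin cap of `A′` for some unit `{111}` normal `n′`.  Here the twin-cap branch is ORIENTED,
exactly as `exit_unsaturated_or_twinCap` (`…ExitCertified`) does for exits above a full predecessor: the
arrival direction is positive, `⟪A′ w₀, n′⟫ = √(2/3)`.  The in-plane value `0` is excluded because the three
far slots of `n′` would all be orthogonal to `w₀` (each candidate angle puts an occupied neighbour of `e` on an
empty far slot of `f`), and `−√(2/3)` because `e = f − A′ w₀` would sit on an empty far slot.  Consequently the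
walker's next cap normal is one of the two normals of `A′` through `A′ w₀` (`…TwinNormals`).

* `nonneg_of_adjacent_pos` — bookkeeping: a slot adjacent (`60°`) to an `n`-positive slot is not
  `n`-negative.
* **`capper_unsaturated_or_twinCap`** — the oriented capper trichotomy.

WHAT THIS IS NOT: not the stub; one local step; F-C1 not moved.
-/

noncomputable section

namespace Summit.Ventures.Crystal3D.Theorems

open Finset
open scoped InnerProductSpace

variable {X : Finset (EuclideanSpace ℝ (Fin 3))}

/-- A slot at `60°` from an `n`-positive slot is `n`-non-negative (the positive and negative triples of a
`{111}` normal meet only at `120°` and `180°`). -/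
theorem nonneg_of_adjacent_pos (A : EuclideanSpace ℝ (Fin 3) ≃ₗᵢ[ℝ] EuclideanSpace ℝ (Fin 3))
    {n : EuclideanSpace ℝ (Fin 3)} (hn : ‖n‖ = 1)
    (hmenu : ∀ w ∈ fccSlots, ⟪A w, n⟫_ℝ = 0 ∨ ⟪A w, n⟫_ℝ = Real.sqrt (2 / 3) ∨ ⟪A w, n⟫_ℝ = -Real.sqrt (2 / 3))
    {w₀ p : EuclideanSpace ℝ (Fin 3)} (hw₀ : w₀ ∈ fccSlots) (hp : p ∈ fccSlots) (hpos : 0 < ⟪A w₀, n⟫_ℝ)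
    (hadj : ⟪p, w₀⟫_ℝ = 1 / 2) : 0 ≤ ⟪A p, n⟫_ℝ := by
  by_contra hlt
  push Not at hlt
  have hnp : -p ∈ fccSlots := neg_mem_fccSlots hp
  have hnpos : 0 < ⟪A (-p), n⟫_ℝ := by rw [map_neg, inner_neg_left]; linarith
  have hne : -p ≠ w₀ := by
    intro h
    have : ⟪p, w₀⟫_ℝ = -1 := by
      rw [← h, inner_neg_right, real_inner_self_eq_norm_sq, norm_eq_one_of_mem_fccSlots hp]; norm_num
    rw [hadj] at this; norm_num at this
  have h := inner_eq_half_of_pos_pos A hn hmenu hnp hw₀ hne hnpos hpos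
  rw [inner_neg_left, hadj] at h
  norm_num at h

/-- **The oriented capper trichotomy.**  `X` `1`-separated; the C12-55 row certified (`ExactOnly` of the
open hemisphere of one slot `s₀` about the origin); `e ∈ X` an exact twin cap seen in its TWIN frame `A′`
with unit menu normal `n`: every slot `e + A′ w` with `⟪A′ w, n⟫ ≥ 0` is occupied; `f = e + A′ w₀` a capper
(`⟪A′ w₀, n⟫ > 0`).  Then `f` has at most eleven contacts, OR all twelve `A′`-slots of `f` are occupied, OR `f`
is an exact twin cap of `A′` for a unit menu normal `n′` with `⟪A′ w₀, n′⟫ = √(2/3)`: the slots `f + A′ w`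
with `⟪A′ w, n′⟫ ≤ 0` are occupied, those with `⟪A′ w, n′⟫ > 0` are empty and their mirror images
`f − A′ w + 2⟪A′ w, n′⟫ n′` are occupied. -/
theorem capper_unsaturated_or_twinCap (hX : ∀ p ∈ X, ∀ q ∈ X, p ≠ q → 1 ≤ dist p q)
    {s₀ : EuclideanSpace ℝ (Fin 3)} (hs₀ : s₀ ∈ fccSlots)
    (hcert : ExactOnly 0 (fccSlots.filter fun w => 0 < ⟪w, s₀⟫_ℝ))
    (A' : EuclideanSpace ℝ (Fin 3) ≃ₗᵢ[ℝ] EuclideanSpace ℝ (Fin 3)) {n : EuclideanSpace ℝ (Fin 3)}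
    (hn : ‖n‖ = 1)
    (hmenu : ∀ w ∈ fccSlots, ⟪A' w, n⟫_ℝ = 0 ∨ ⟪A' w, n⟫_ℝ = Real.sqrt (2 / 3) ∨ ⟪A' w, n⟫_ℝ = -Real.sqrt (2 / 3))
    {e : EuclideanSpace ℝ (Fin 3)} (he : e ∈ X) (hocc : ∀ w ∈ fccSlots, 0 ≤ ⟪A' w, n⟫_ℝ → e + A' w ∈ X)
    {w₀ : EuclideanSpace ℝ (Fin 3)} (hw₀ : w₀ ∈ fccSlots) (hpos : 0 < ⟪A' w₀, n⟫_ℝ) :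
    (X.filter fun q => dist (e + A' w₀) q = 1).card ≤ 11 ∨
    (∀ w ∈ fccSlots, e + A' w₀ + A' w ∈ X) ∨
    ∃ n' : EuclideanSpace ℝ (Fin 3), ‖n'‖ = 1 ∧
      (∀ w ∈ fccSlots, ⟪A' w, n'⟫_ℝ = 0 ∨ ⟪A' w, n'⟫_ℝ = Real.sqrt (2 / 3) ∨ ⟪A' w, n'⟫_ℝ = -Real.sqrt (2 / 3)) ∧
      ⟪A' w₀, n'⟫_ℝ = Real.sqrt (2 / 3) ∧
      (∀ w ∈ fccSlots, ⟪A' w, n'⟫_ℝ ≤ 0 → e + A' w₀ + A' w ∈ X) ∧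
      (∀ w ∈ fccSlots, 0 < ⟪A' w, n'⟫_ℝ →
        e + A' w₀ + A' w ∉ X ∧ e + A' w₀ - A' w + (2 * ⟪A' w, n'⟫_ℝ) • n' ∈ X) := by
  classical
  rcases capper_trichotomy hX hs₀ hcert A' hmenu he hocc hw₀ hpos with h11 | hfull | ⟨n', hn', hmenu', hle, hgt⟩
  · exact Or.inl h11
  · exact Or.inr (Or.inl hfull)
  · refine Or.inr (Or.inr ⟨n', hn', hmenu', ?_, hle, hgt⟩)
    have hrpos : 0 < Real.sqrt (2 / 3) := Real.sqrt_pos.2 (by norm_num)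
    have hd : ⟪A' w₀, n⟫_ℝ = Real.sqrt (2 / 3) := by
      rcases hmenu w₀ hw₀ with h | h | h
      · rw [h] at hpos; exact absurd hpos (lt_irrefl 0)
      · exact h
      · rw [h] at hpos; linarith
    rcases hmenu' w₀ hw₀ with h0 | hfar | hneg
    · exfalso
      obtain ⟨p₁, hp₁, p₂, hp₂, p₃, hp₃, hn₁, hn₂, hn₃, -, -, -, hind, -⟩ := exists_far_frame A' hn' hmenu'
      -- each far slot `p` of `n′` is orthogonal to `w₀`
      have horth : ∀ p ∈ fccSlots, ⟪A' p, n'⟫_ℝ = Real.sqrt (2 / 3) → ⟪p, w₀⟫_ℝ = 0 := by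
        intro p hp hpn
        have hppos : 0 < ⟪A' p, n'⟫_ℝ := by rw [hpn]; exact hrpos
        rcases inner_slots_mem hp hw₀ with h | h | h | h | h
        · -- `p = w₀`: but `⟪A′ w₀, n′⟫ = 0`
          have := eq_of_inner_eq_one hp hw₀ h
          rw [← this, h0] at hpn; exact absurd hpn (ne_of_lt hrpos)
        · -- `p − w₀` is a far slot of `n′`, hence empty at `f`; but `f + A′(p − w₀) = e + A′ p ∈ X`
          have hs : p - w₀ ∈ fccSlots := sub_mem_fccSlots_of_inner_eq_half hp hw₀ h
          have hspos : 0 < ⟪A' (p - w₀), n'⟫_ℝ := by rw [map_sub, inner_sub_left, h0, sub_zero]; exact hppos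
          have hpn0 : 0 ≤ ⟪A' p, n⟫_ℝ := nonneg_of_adjacent_pos A' hn hmenu hw₀ hp hpos h
          have hmem : e + A' w₀ + A' (p - w₀) ∈ X := by
            rw [map_sub, add_add_sub_cancel]; exact hocc p hp hpn0
          exact absurd hmem (hgt _ hs hspos).1
        · exact h
        · -- `w₀ + p` is a slot on the non-negative side of `n`, so `f + A′ p = e + A′(w₀ + p) ∈ X`; but `p` is far
          have hs : w₀ + p ∈ fccSlots :=
            add_mem_fccSlots_of_inner_eq_neg_half hw₀ hp (by rw [real_inner_comm]; exact h)
          have hsn : 0 ≤ ⟪A' (w₀ + p), n⟫_ℝ := by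
            rw [map_add, inner_add_left, hd]
            rcases hmenu p hp with h' | h' | h' <;> rw [h'] <;> linarith
          have hmem : e + A' w₀ + A' p ∈ X := by
            have := hocc _ hs hsn; rwa [map_add, ← add_assoc] at this
          exact absurd hmem (hgt p hp hppos).1
        · -- `p = −w₀`: then `⟪A′ p, n′⟫ = 0`
          have := eq_neg_of_inner_eq_neg_one hp hw₀ h
          have e' : p = -w₀ := by rw [this, neg_neg]
          have hpn' : ⟪A' p, n'⟫_ℝ = 0 := by
            rw [e', map_neg, inner_neg_left, h0, neg_zero]
          rw [hpn'] at hpn; exact absurd hpn (ne_of_lt hrpos)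
      have hw0 : w₀ = 0 :=
        eq_zero_of_inner_eq_zero_of_indep hind (horth p₁ hp₁ hn₁) (horth p₂ hp₂ hn₂) (horth p₃ hp₃ hn₃)
      have := norm_eq_one_of_mem_fccSlots hw₀
      rw [hw0, norm_zero] at this; exact one_ne_zero this.symm
    · exact hfar
    · exfalso
      -- `−w₀` would be a far slot of `n′`, hence empty; but `f + A′(−w₀) = e ∈ X`
      have hs := neg_mem_fccSlots hw₀
      have hspos : 0 < ⟪A' (-w₀), n'⟫_ℝ := by rw [map_neg, inner_neg_left, hneg, neg_neg]; exact hrpos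
      have hmem : e + A' w₀ + A' (-w₀) ∈ X := by rw [map_neg, add_neg_cancel_right]; exact he
      exact (hgt _ hs hspos).1 hmem

end Summit.Ventures.Crystal3D.Theorems

end
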